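import Summits.AtomisticToContinuum.Crystallization.Theorems.ExcessDecayLiouvilleHcpLiouvilleBlowdownCaccioppoliOwn
import Summits.AtomisticToContinuum.Crystallization.Theorems.ExcessDecayLiouvilleHcpLiouvilleCoreOfCaccioppoli

/-!
# Line `near-balance` (crux-strategist s2, 2026-08-17) for the crux `HcpLiouville` (stmt-AtomisticToContinuum-9332)

ALTERNATIVE line (the lead's skeleton `Lines/Sketch.lean` v5.3 is untouched).  Lever: the own-field secant
coercivity that the blow-down's nonlinear Caccioppoli step consumes (lead stub A2′ `stub_ownSecantCoercive`,
required there for ALL box fields `v`) is in fact consumed ONLY at the displacement field of the EQUILIBRIUM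
itself (`v = LevelOne.vField t A τ u`, see the landed proof of `stub_caccioppoli_own`: `hinst := hown … (vField t A τ u) …`).
Equilibrium fields are NEAR-BALANCED at every site: the force of the sites within distance `6` is the negative of
the far-field force, which is `≤ 1/4` by the `r⁻⁷` tail (crude count `32 r³`).  So the certificate target can be
RESTRICTED to near-balanced box fields (an S-procedure / Positivstellensatz use of the crux's own hypothesis
`Equil X` inside the certificate).  Near-balance kills the cell-scale (short-wave) distortions of amplitude
`≳ 0.006` (single-site stiffness ≈ 42, zone-boundary stiffness ≈ 40 against the slack 1/4) — exactly the
10–15 % cell strains at which the null-Lagrangian-corrected cells of the lead's architecture turn NEGATIVE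
(vertex radius 1/20, kit j011259), while the GLOBAL own-field ratio stays ≥ 0.11 up to tube radius 3/40
(kit j008231) — so the restricted target keeps the truth of A2′ and removes its uncertifiable corner.

Composition (kernel-checked below, `sorry` only inside `stub_*`):
  `stub_relaxedShift` (shared with Sketch A1, identical statement)
  `stub_nearBalance`      — analytic (M): equilibrium displacement fields are `NearBalanced 6 (1/4)`;
  `stub_nbOwnSecantCoercive` — THE certificate: A2′ verbatim with the extra hypothesis `NearBalanced 6 (1/4) … v`;
  `caccioppoli_of_nb`     — proved here (the landed `stub_caccioppoli_own` proof with the restricted instance);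
  `HcpLiouville_of`       — by name, through the landed `stub_core_of_caccioppoli` (blow-down) and
                             `BlowdownLine.hcpLiouville_iff`.
-/

noncomputable section

namespace Summit.AtomisticToContinuum.Crystallization.Cruxes.HcpLiouville.Lines.NearBalance

open scoped BigOperators Topology Classical InnerProductSpace RealInnerProductSpace
open Literature.MathematicalPhysics.StatisticalMechanics
open Summit.AtomisticToContinuum.Crystallization.Theses.ExcessDecayLiouville
open Summit.AtomisticToContinuum.Crystallization.Theorems.PhononStabilityNegative
open Summit.AtomisticToContinuum.Crystallization.Theorems.ExcessDecayLiouville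

local notation "E3" => EuclideanSpace ℝ (Fin 3)

/-! ## The near-balance predicate -/

/-- **Near-balance** of a field `v` on a site set `S` (truncation radius `rc`, slack `β`): at every site `p ∈ S` the
Lennard-Jones force exerted on the displaced site `p + v p` by the displaced sites `q + v q`, `q ∈ S`,
`0 < dist p q ≤ rc`, has norm `≤ β` (a finite sum; `Blowdown.ljForce e = (V′(|e|)/|e|)·e` is the pair force along the
bond vector `e = (p + v p) − (q + v q)`, the same orientation as the `Equil₀` rows).  Route-internal bookkeeping
predicate with parameters, not a literature fact. [folklore] -/
def NearBalanced (rc β : ℝ) (S : Set E3) (v : E3 → E3) : Prop :=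
  ∀ p ∈ S, ‖∑' q : S, (if 0 < dist p (q : E3) ∧ dist p (q : E3) ≤ rc then
      Blowdown.ljForce ((p + v p) - ((q : E3) + v q)) else 0)‖ ≤ β

/-! ## Open stubs -/

/-- Stub 1 (CERTIFIED COMPUTATION, shared verbatim with `Lines/Sketch.lean` stub A1): every admissible cell has a zero of its
optical force within `1/40` of the geometric hcp shift (floats: max deviation 0.0227; slack 0.0023). -/
theorem stub_relaxedShift :
    ∀ (A : E3 →L[ℝ] E3), Adm₀ A →
      ∃ e : E3, ‖e - A (barlowOffset 1 + layerNormal (Real.sqrt (2 / 3)))‖ ≤ 1 / 40 ∧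
        HasSum (fun z : Λ₀ => (deriv lennardJones ‖e + A z‖ / ‖e + A z‖) • (e + A z)) 0 := by
  sorry

/-- Stub 2 (ANALYTIC, M): **equilibria are near-balanced.**  For an equilibrium `X` in displacement form over an admissible
hcp-like datum and a relaxed anchor `τ` (`‖τ‖ ≤ 1/20`, anchored datum hcp-like, anchored sites in force balance), the
displacement `v = LevelOne.vField t A τ u` of `X` seen from the anchored sites `S*` is `NearBalanced 6 (1/4)` on `S*`:
each full force row vanishes (`Equil₀ X`, transported to `S*` by `LevelOne.fwd/bwd`, cf. `levelOne_linearEq`), so the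
truncated row equals minus its tail `dist p q > 6`, and `|V′(r)| ≤ r⁻¹³ + r⁻⁷ ≤ 2 r⁻⁷` (`r ≥ dist − 3/20 ≥ 1`) with at most
`32 (k+1)³` sites in the shell `k ≤ dist < k+1` (`LevelOne.card_sites_le`) gives the tail `Σ_{k ≥ 6} 64 (k+1)³ (k − 3/20)⁻⁷ < 0.21 ≤ 1/4`. -/
theorem stub_nearBalance :
    ∀ (X : Set E3) (t : Fin 2 → E3) (A : E3 →L[ℝ] E3) (u : E3 → E3) (τ : E3),
      Adm₀ A → Inner₀ t A → Equil₀ X → IsDisplacement X t A u → ‖τ‖ ≤ 1 / 20 →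
      Inner₀ (anchorDatum t τ) A → Equil₀ (Sites₀ (anchorDatum t τ) A) →
        NearBalanced 6 (1 / 4) (Sites₀ (anchorDatum t τ) A) (LevelOne.vField t A τ u) := by
  sorry

/-- Stub 3 (THE CERTIFICATE; computation + analysis, XL): **own-field ray-secant coercivity at anchor radius `1/20` for
NEAR-BALANCED box fields** — the lead's stub A2′ verbatim, with the one extra hypothesis `NearBalanced 6 (1/4) S* v`.
Intended proof: null-Lagrangian-corrected tetra/octa CELLS of the hcp contact complex (kit j011259 architecture) minimised over
the near-balanced part of the vertex tube only (constraint = truncated force ≤ 1/4 + inner tails at the cluster's sites), the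
homogeneous optical offset `τ` handled as a ray (RAYSECANT-j022373: secant zero along c at 0.115 > reach 0.095), far field booked by
path bounds (`hcpLiouville_pathBound`); floats to measure first: constrained vs unconstrained cell ratios at vertex radius 1/20–3/40. -/
theorem stub_nbOwnSecantCoercive :
    ∃ κ₁ : ℝ, 0 < κ₁ ∧
      ∀ (t : Fin 2 → E3) (A : E3 →L[ℝ] E3) (τ : E3), Adm₀ A → Inner₀ t A → ‖τ‖ ≤ 1 / 20 →
        Inner₀ (anchorDatum t τ) A → Equil₀ (Sites₀ (anchorDatum t τ) A) →
        ∀ v : E3 → E3, (∀ s ∈ Sites₀ (anchorDatum t τ) A, ‖v s + shiftField (anchorDatum t τ) A τ s‖ ≤ 1 / 40) →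
          NearBalanced 6 (1 / 4) (Sites₀ (anchorDatum t τ) A) v →
          ∀ (c : E3) (R : ℝ) (m : E3), 1 ≤ R → ‖m‖ ≤ 1 →
            κ₁ * nnForm (anchorDatum t τ) A
                (fun p => LevelOne.cutoff (Sites₀ (anchorDatum t τ) A) c R p • (v p - m)) ≤
              secFormAt (anchorDatum t τ) A v
                (fun p => LevelOne.cutoff (Sites₀ (anchorDatum t τ) A) c R p • (v p - m)) / 2 := by
  sorry

/-! ## The restricted target is weaker than the lead's A2′ (no costume: A2′ ⇒ stub 3 by forgetting the hypothesis) -/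

/-- The lead's own-field input (A2′ of `Lines/Sketch.lean`, for ALL box fields) implies the near-balanced one trivially. -/
theorem nbOwnSecantCoercive_of_own {κ₁ : ℝ}
    (hown : ∀ (t : Fin 2 → E3) (A : E3 →L[ℝ] E3) (τ : E3), Adm₀ A → Inner₀ t A → ‖τ‖ ≤ 1 / 20 →
        Inner₀ (anchorDatum t τ) A → Equil₀ (Sites₀ (anchorDatum t τ) A) →
        ∀ v : E3 → E3, (∀ s ∈ Sites₀ (anchorDatum t τ) A, ‖v s + shiftField (anchorDatum t τ) A τ s‖ ≤ 1 / 40) →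
          ∀ (c : E3) (R : ℝ) (m : E3), 1 ≤ R → ‖m‖ ≤ 1 →
            κ₁ * nnForm (anchorDatum t τ) A
                (fun p => LevelOne.cutoff (Sites₀ (anchorDatum t τ) A) c R p • (v p - m)) ≤
              secFormAt (anchorDatum t τ) A v
                (fun p => LevelOne.cutoff (Sites₀ (anchorDatum t τ) A) c R p • (v p - m)) / 2) :
    ∀ (t : Fin 2 → E3) (A : E3 →L[ℝ] E3) (τ : E3), Adm₀ A → Inner₀ t A → ‖τ‖ ≤ 1 / 20 →
        Inner₀ (anchorDatum t τ) A → Equil₀ (Sites₀ (anchorDatum t τ) A) →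
        ∀ v : E3 → E3, (∀ s ∈ Sites₀ (anchorDatum t τ) A, ‖v s + shiftField (anchorDatum t τ) A τ s‖ ≤ 1 / 40) →
          NearBalanced 6 (1 / 4) (Sites₀ (anchorDatum t τ) A) v →
          ∀ (c : E3) (R : ℝ) (m : E3), 1 ≤ R → ‖m‖ ≤ 1 →
            κ₁ * nnForm (anchorDatum t τ) A
                (fun p => LevelOne.cutoff (Sites₀ (anchorDatum t τ) A) c R p • (v p - m)) ≤
              secFormAt (anchorDatum t τ) A v
                (fun p => LevelOne.cutoff (Sites₀ (anchorDatum t τ) A) c R p • (v p - m)) / 2 :=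
  fun t A τ hA hI hρ hIτ hEτ v hv _ c R m hR hm => hown t A τ hA hI hρ hIτ hEτ v hv c R m hR hm

/-! ## Glue (proved): near-balance + restricted coercivity ⇒ the Caccioppoli interface of the blow-down -/

/-- **Caccioppoli from the near-balanced own-field input.**  `Blowdown.CaccioppoliProp (1/20) C` with `C = 230000·K₀/κ₁` — the
landed proof of `stub_caccioppoli_own` verbatim, the coercivity instance being taken at the solution's own field
`v = LevelOne.vField t A τ u`, which is in the box (`IsDisplacement`) AND near-balanced (stub 2). -/
theorem caccioppoli_of_nb (κ₁ : ℝ) (hκ₁ : 0 < κ₁)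
    (hNB : ∀ (X : Set E3) (t : Fin 2 → E3) (A : E3 →L[ℝ] E3) (u : E3 → E3) (τ : E3),
      Adm₀ A → Inner₀ t A → Equil₀ X → IsDisplacement X t A u → ‖τ‖ ≤ 1 / 20 →
      Inner₀ (anchorDatum t τ) A → Equil₀ (Sites₀ (anchorDatum t τ) A) →
        NearBalanced 6 (1 / 4) (Sites₀ (anchorDatum t τ) A) (LevelOne.vField t A τ u))
    (hcoer : ∀ (t : Fin 2 → E3) (A : E3 →L[ℝ] E3) (τ : E3), Adm₀ A → Inner₀ t A → ‖τ‖ ≤ 1 / 20 →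
        Inner₀ (anchorDatum t τ) A → Equil₀ (Sites₀ (anchorDatum t τ) A) →
        ∀ v : E3 → E3, (∀ s ∈ Sites₀ (anchorDatum t τ) A, ‖v s + shiftField (anchorDatum t τ) A τ s‖ ≤ 1 / 40) →
          NearBalanced 6 (1 / 4) (Sites₀ (anchorDatum t τ) A) v →
          ∀ (c : E3) (R : ℝ) (m : E3), 1 ≤ R → ‖m‖ ≤ 1 →
            κ₁ * nnForm (anchorDatum t τ) A
                (fun p => LevelOne.cutoff (Sites₀ (anchorDatum t τ) A) c R p • (v p - m)) ≤
              secFormAt (anchorDatum t τ) A v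
                (fun p => LevelOne.cutoff (Sites₀ (anchorDatum t τ) A) c R p • (v p - m)) / 2) :
    ∃ C : ℝ, Blowdown.CaccioppoliProp (1 / 20) C := by
  refine ⟨230000 * LevelOne.K₀ / κ₁, ?_⟩
  intro X t A u τ hA hI hEX hu hρ hIτ hEτ c R m hR hm
  have hK := LevelOne.K₀_pos
  have hR0 : 0 < R := by linarith
  -- the endpoint configuration of `v = vField t A τ u` lies in the `1/40`-box of the original datum
  have hbox : ∀ s ∈ Sites₀ (anchorDatum t τ) A,
      ‖LevelOne.vField t A τ u s + shiftField (anchorDatum t τ) A τ s‖ ≤ 1 / 40 :=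
    fun s hs => by rw [LevelOne.vField_add_shiftField]; exact hu.1 _ (LevelOne.bwd_mem hA hIτ hs)
  -- the solution's own field is near-balanced (stub 2)
  have hnb : NearBalanced 6 (1 / 4) (Sites₀ (anchorDatum t τ) A) (LevelOne.vField t A τ u) :=
    hNB X t A u τ hA hI hEX hu hρ hIτ hEτ
  -- the restricted own-field inequality at every cut-off radius `R' ≥ 1`
  have hinst : ∀ R' : ℝ, 1 ≤ R' →
      κ₁ * nnForm (anchorDatum t τ) A
          (fun p => LevelOne.cutoff (Sites₀ (anchorDatum t τ) A) c R' p • (LevelOne.vField t A τ u p - m)) ≤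
        secFormAt (anchorDatum t τ) A (LevelOne.vField t A τ u)
          (fun p => LevelOne.cutoff (Sites₀ (anchorDatum t τ) A) c R' p • (LevelOne.vField t A τ u p - m)) / 2 :=
    fun R' hR' => hcoer t A τ hA hI hρ hIτ hEτ (LevelOne.vField t A τ u) hbox hnb c R' m hR' hm
  set N := Blowdown.nnEnergy (Sites₀ (anchorDatum t τ) A) (LevelOne.vField t A τ u) c R with hN
  set O := Blowdown.oscAt (Sites₀ (anchorDatum t τ) A) (LevelOne.vField t A τ u) c (4 * R) m with hO
  have hO0 : 0 ≤ O := Blowdown.oscAt_nonneg _ _ _ _ _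
  have hX0 : 0 ≤ (R⁻¹) ^ 2 := by positivity
  have h7 : 0 ≤ LevelOne.K₀ * (R⁻¹) ^ 2 * O := mul_nonneg (mul_nonneg hK.le hX0) hO0
  have h8 : 0 ≤ LevelOne.K₀ * (R⁻¹) ^ 2 := mul_nonneg hK.le hX0
  have hfin : κ₁ * N ≤ LevelOne.K₀ * (R⁻¹) ^ 2 * O + 226000 * LevelOne.K₀ * (R⁻¹) ^ 2 := by
    by_cases h4 : 4 ≤ R
    · have key := Blowdown.nnEnergy_le_main_own hκ₁.le hA hI hIτ hEτ hu hEX c (R := R) (R' := 4 * R / 3)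
        (by linarith) (by linarith) hm (hinst (4 * R / 3) (by linarith))
      have h3 : 3 * (4 * R / 3) = 4 * R := by ring
      rw [h3] at key
      have hinv : ((4 * R / 3)⁻¹) ^ 2 ≤ (R⁻¹) ^ 2 :=
        pow_le_pow_left₀ (inv_nonneg.2 (by positivity)) (inv_anti₀ hR0 (by linarith)) 2
      have h5 : LevelOne.K₀ * ((4 * R / 3)⁻¹) ^ 2 * O ≤ LevelOne.K₀ * (R⁻¹) ^ 2 * O :=
        mul_le_mul_of_nonneg_right (mul_le_mul_of_nonneg_left hinv hK.le) hO0
      have h6 : 155 * LevelOne.K₀ * ((4 * R / 3)⁻¹) ^ 2 ≤ 155 * LevelOne.K₀ * (R⁻¹) ^ 2 :=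
        mul_le_mul_of_nonneg_left hinv (by positivity)
      linarith
    · push Not at h4
      have key := Blowdown.nnEnergy_le_main_own hκ₁.le hA hI hIτ hEτ hu hEX c (R := R) (R' := R + 2)
        (by linarith) (by linarith) hm (hinst (R + 2) (by linarith))
      have hosc : Blowdown.oscAt (Sites₀ (anchorDatum t τ) A) (LevelOne.vField t A τ u) c (3 * (R + 2)) m ≤
          121 / 100 * (32 * (3 * (R + 2)) ^ 3) :=
        Blowdown.oscAt_le_of_sq_le hA hIτ _ (fun p hp => Blowdown.sq_norm_vField_sub_const_le hA hI hIτ hu hm hp)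
          (by norm_num) c (by linarith)
      have hcube : (3 * (R + 2)) ^ 3 ≤ (18 : ℝ) ^ 3 := pow_le_pow_left₀ (by linarith) (by linarith) 3
      have hY0 : 0 ≤ ((R + 2)⁻¹) ^ 2 := by positivity
      have hinv : ((R + 2)⁻¹) ^ 2 ≤ (R⁻¹) ^ 2 :=
        pow_le_pow_left₀ (inv_nonneg.2 (by linarith)) (inv_anti₀ hR0 (by linarith)) 2
      have hosc' : Blowdown.oscAt (Sites₀ (anchorDatum t τ) A) (LevelOne.vField t A τ u) c (3 * (R + 2)) m ≤
          225816 := by nlinarith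
      have h9 : LevelOne.K₀ * ((R + 2)⁻¹) ^ 2 *
          Blowdown.oscAt (Sites₀ (anchorDatum t τ) A) (LevelOne.vField t A τ u) c (3 * (R + 2)) m ≤
          LevelOne.K₀ * ((R + 2)⁻¹) ^ 2 * 225816 :=
        mul_le_mul_of_nonneg_left hosc' (mul_nonneg hK.le hY0)
      have h10 : LevelOne.K₀ * ((R + 2)⁻¹) ^ 2 ≤ LevelOne.K₀ * (R⁻¹) ^ 2 := mul_le_mul_of_nonneg_left hinv hK.le
      linarith
  rw [div_mul_eq_mul_div, le_div_iff₀ hκ₁]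
  linarith

/-! ## The crux from the line -/

/-- **The crux `HcpLiouville`, concluded by name** from `stub_relaxedShift`, `stub_nearBalance`, `stub_nbOwnSecantCoercive`
through the glue above and the landed blow-down (`stub_core_of_caccioppoli`, p154839) — `PhononStability` enters as the crux's
own inline hypothesis via `BlowdownLine.hcpLiouville_iff`. -/
theorem HcpLiouville_of : HcpLiouville := by
  obtain ⟨κ₁, hκ₁, hcoer⟩ := stub_nbOwnSecantCoercive
  exact BlowdownLine.hcpLiouville_iff.2
    (stub_core_of_caccioppoli stub_relaxedShift (caccioppoli_of_nb κ₁ hκ₁ stub_nearBalance hcoer))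

end Summit.AtomisticToContinuum.Crystallization.Cruxes.HcpLiouville.Lines.NearBalance

end
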